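import Summits.QuantumFields.YangMills.Theorems.UnitScaleTiltProp7SiteEntryCoordinates
import HarnessLib

/-!
# Route `UnitScaleTilt`, crux «MinimiserStabilityRegPr» (stmt-QuantumFields-19200, stub EX), positivity block, the LOD ∕ Combes–Thomas line (★★OWNER RULINGS №33 ∕ №34; brick (L3′a),
# px5 g11's LOCATE-L3a row (b1)) — **THE COVARIANT LAPLACIAN `Δ^η_{U₀} = D*_{U₀}D_{U₀}` ON THE GAUGE PARAMETERS IN SITE⊗ENTRY SPIKE COORDINATES: RANGE ONE, ENTRIES `≤ 6η⁻²`,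
# SYMMETRIC; THE COSH-BUDGET ROW OF ✓`Prop7HermitianCoshBudgetCT` FOR ITS MATRIX IS `≤ 144·η⁻²·(cosh s − 1)` FOR ANY SITE WEIGHT OF NEIGHBOUR-SLOPE `s`**
# (width seat `ym3-torus-px17` gen 8, 2026-08-29)

Cell `ym3-torus` (HUMAN RULING D-0037: YM₃ on T³ is ladder rung R3 — NOT d = 4, NOT infinite volume, NOT a mass gap, NOT Clay).  THEOREMS ONLY (0 `def`, 0 `sorry`);
`--supports stmt-QuantumFields-19200 --as helper`, count-neutral.  HONEST LABEL (№33 (6) ∕ №34): engine-side letters of the curved γ-row supplier line (LOD localisation; «no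
RANDOM-WALK organ; ONE Thm 3.1-class Agmon brick (L3′) inside, Track A road cited»); nothing of (L3′a)'s member budget check for `Δ_U + aQ″†Q″` (px5's ∕ the chair's file on the
★★OWNER's word), (3.49), Thm 3.1 ∕ 3.3, `h349`, `hGF`, EX or the crux is proved here.

THE POINT.  At the T³ member the covariant gradient of a spike `δ_x⊗A` lives on the six bonds at `x`: `(D_{U₀}(δ_x⊗A))(b) = η⁻¹([b₊ = x]·U₀(b)AU₀(b)⋆ − [b₋ = x]·A)`
(✓`Prop7SectET3HilbertLetters.DL2_apply`; `b₊ ≠ b₋` on every torus of the series), and `U₀(b) ∈ SU(2)` preserves the Frobenius norm.  Hence (§2) `‖D_{U₀}(toL2S(δ_x⊗A))‖² =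
6·c₀·η⁻²·‖A‖_F²` EXACTLY, (§3) `⟪toL2S(δ_{x′}⊗B), Δ_{U₀} toL2S(δ_x⊗A)⟫ = ⟪D·, D·⟫` VANISHES unless `x′ = x` or `x′`, `x` are lattice neighbours (RANGE 1) and is bounded by
`6c₀η⁻²‖A‖_F‖B‖_F` (Cauchy–Schwarz) — in the normalised spikes of ✓`Prop7SiteEntryCoordinates`: entries of modulus `≤ 6η⁻²`, zero beyond neighbours, Hermitian
(`isSymmetric_covLapSite` + ✓`isHermitian_toMatrixOrthonormal_of_isSymmetric`); (§4) for any site weights `ρ` with `ρ x x = 0` and `|ρ x x′| ≤ s` on neighbours, the row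
`Σ_l (cosh ρ(x_i, x_l) − 1)·|⟪e_i, Δ_{U₀}e_l⟫| ≤ 144·η⁻²·(cosh s − 1)` — the `hrow` letter of ✓`inv_decay_of_hermitian_coshBudget` for the `Δ_U` part (`s = μη` for the fine-Lipschitz
Agmon weight: `≤ 80μ²`, K-UNIFORM); the `aQ″†Q″` part is block-supported by ✓`Prop7TopMeanAdjointBlockLocal`.

WHAT IS PROVED (ns `…Theorems.Prop7CovLapSiteEntryRows`; T³ member `F`, `n K`, weight `c₀ > 0`, background `U₀`).
* §1 `inner_covLapSite_eq_inner_DL2` (`⟪v, Δw⟫ = ⟪Dv, Dw⟫`), `isSymmetric_covLapSite`, `re_inner_covLapSite_nonneg`.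
* §2 `toL2_symm_DL2_toL2S_single` (the spike gradient, bondwise), `…_eq_zero` (support), `sum_normSq_conj_specialUnitary` (Frobenius invariance), `sum_ite_src_eq`∕`sum_ite_tgt_eq` (three
  bonds out of ∕ into a site), ★`normSq_DL2_toL2S_single_eq` (`= 6c₀η⁻²Σ|A_{jk}|²`), `normSq_DL2_spike_eq` (`= 6η⁻²` for a normalised spike).
* §3 ★★`inner_toL2S_single_covLapSite_eq_zero_of_far` (RANGE 1), ★`norm_inner_toL2S_single_covLapSite_le`, ★`norm_inner_spike_covLapSite_spike_le` (`≤ 6η⁻²`),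
  `inner_spike_covLapSite_spike_eq_zero_of_far`.
* §4 ★★`coshBudget_row_covLapSite_le` (`≤ 144η⁻²(cosh s − 1)`).
HONEST SCOPE.  Stencil bookkeeping of one second-order lattice operator; no inverse, no decay, no `Q″` term; nothing continuum ∕ OS ∕ mass-gap ∕ Clay.

References: T. Bałaban, CMP **99** (1985) 389–434 [Balaban1985BackgroundPropagators] ((3.3) p.391, (3.8) p.392, (3.11) p.392, (3.23) p.394, (3.49) p.399); CMP **98** (1985) 17–51
[Balaban1985Averaging] ((18)–(19) p.21).
-/

set_option autoImplicit false

noncomputable section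

open scoped BigOperators InnerProductSpace ComplexConjugate Matrix

namespace Summit.QuantumFields.YangMills.Theorems.Prop7CovLapSiteEntryRows

open Literature.MathematicalPhysics.QuantumFieldTheory.Balaban1983to89
open Literature.MathematicalPhysics.QuantumFieldTheory.Balaban1983to89.T3ContinuumYM3Torus
open B9Eq311L2Pairing (WL2)
open B11Eq103H1Complex (SiteL2K BondL2K)
open B10StarCount (shift_unshift unshift_shift)
open T3SectALandauChart (eta eta_pos)
open Summit.QuantumFields.YangMills.Theorems.Prop7SectET3Transport (periodsT3 bondEquiv bgOfCfg val_bgOfCfg isUnitaryBg_bgOfCfg)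
open Summit.QuantumFields.YangMills.Theorems.Prop7SectET3HilbertLetters (W₂ toL2 toL2S DL2 DstarL2 covLapSite adjoint_DL2 DL2_apply inner_toL2)
open Summit.QuantumFields.YangMills.Theorems.Prop7NestedMeanPoincare (normSq_toL2_eq)
open Summit.QuantumFields.YangMills.Theorems.Prop7SiteEntryCoordinates (orthonormal_spike)

variable (F : T3Family) {n K : ℕ} {c₀ : ℝ} [Fact (0 < c₀)]

/-! ## §1 `Δ_U = D†D`: polarisation and symmetry -/

/-- `⟪v, Δ^η_{U₀} w⟫ = ⟪D_{U₀}v, D_{U₀}w⟫` (polarised ✓`inner_covLapSite`, via ✓`adjoint_DL2`). [cite: Balaban1985BackgroundPropagators, (3.23) p.394, (3.8) p.392] -/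
theorem inner_covLapSite_eq_inner_DL2 (U₀ : GaugeField (F.P K) 0 (Matrix.specialUnitaryGroup (Fin 2) ℂ)) (v w : SiteL2K ℂ 3 (periodsT3 F K) c₀ W₂) :
    ⟪v, covLapSite F n K c₀ U₀ w⟫_ℂ = ⟪DL2 F n K c₀ U₀ v, DL2 F n K c₀ U₀ w⟫_ℂ := by
  rw [covLapSite, LinearMap.comp_apply, ← adjoint_DL2, LinearMap.adjoint_inner_right]

/-- `Δ^η_{U₀}` is a symmetric operator of the weighted `L²`. [cite: Balaban1985BackgroundPropagators, (3.23) p.394] -/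
theorem isSymmetric_covLapSite (U₀ : GaugeField (F.P K) 0 (Matrix.specialUnitaryGroup (Fin 2) ℂ)) : (covLapSite F n K c₀ U₀).IsSymmetric := by
  intro v w
  rw [inner_covLapSite_eq_inner_DL2, ← inner_conj_symm, inner_covLapSite_eq_inner_DL2, inner_conj_symm]

/-- `0 ≤ Re⟪v, Δ^η_{U₀} v⟫` (`= ‖Dv‖²`). [cite: Balaban1985BackgroundPropagators, (3.10) p.392, (3.23) p.394] -/
theorem re_inner_covLapSite_nonneg (U₀ : GaugeField (F.P K) 0 (Matrix.specialUnitaryGroup (Fin 2) ℂ)) (v : SiteL2K ℂ 3 (periodsT3 F K) c₀ W₂) :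
    0 ≤ RCLike.re ⟪v, covLapSite F n K c₀ U₀ v⟫_ℂ := by
  rw [inner_covLapSite_eq_inner_DL2, inner_self_eq_norm_sq_to_K]
  norm_cast
  positivity

/-! ## §2 The covariant gradient of a spike: six bonds, Frobenius-invariant transports -/

omit [Fact (0 < c₀)] in
/-- `y + e_μ ≠ y` on every torus of the series (`1 ≠ 0` in `ZMod (2L^{m+K−j})`). [folklore] -/
private theorem shift_ne_self' {j : ℕ} (y : Site (F.P K) j) (μ : Fin (F.P K).d) : y.shift μ ≠ y := by
  intro h
  have h1 := congrFun h μ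
  simp only [Site.shift, Function.update_self] at h1
  exact one_ne_zero (add_eq_left.1 h1)

/-- **THE GRADIENT OF A SPIKE, BONDWISE** ((3.3) at `λ = δ_x⊗A`): `(D_{U₀}(δ_x⊗A))(b) = η⁻¹·([b₊ = x]·U₀(b)·A·U₀(b)⋆ − [b₋ = x]·A)`. [cite: Balaban1985BackgroundPropagators, (3.3) p.391] -/
theorem toL2_symm_DL2_toL2S_single (U₀ : GaugeField (F.P K) 0 (Matrix.specialUnitaryGroup (Fin 2) ℂ)) (x : Site (F.P K) 0) (A : Matrix (Fin 2) (Fin 2) ℂ)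
    (b : PBond (F.P K) 0) :
    (toL2 F K c₀).symm (DL2 F n K c₀ U₀ (toL2S F K c₀ (Pi.single x A))) b
      = (((eta F n K : ℝ) : ℂ)⁻¹) • ((if b.tgt = x then ((U₀ b : Matrix.specialUnitaryGroup (Fin 2) ℂ) : Matrix (Fin 2) (Fin 2) ℂ) * A *
            star (((U₀ b : Matrix.specialUnitaryGroup (Fin 2) ℂ) : Matrix (Fin 2) (Fin 2) ℂ)) else 0) - (if b.src = x then A else 0)) := by
  have hinv : ((((bgOfCfg F K U₀ (bondEquiv F K b))⁻¹ : (Matrix (Fin 2) (Fin 2) ℂ)ˣ) : Matrix (Fin 2) (Fin 2) ℂ)) =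
      star (((U₀ b : Matrix.specialUnitaryGroup (Fin 2) ℂ) : Matrix (Fin 2) (Fin 2) ℂ)) := by
    rw [isUnitaryBg_bgOfCfg, val_bgOfCfg, Equiv.symm_apply_apply]
  rw [DL2_apply, hinv, Pi.single_apply, Pi.single_apply]
  congr 1
  split_ifs <;> simp only [Matrix.mul_zero, Matrix.zero_mul]

/-- **SUPPORT**: the spike gradient vanishes on every bond not touching `x`. [cite: Balaban1985BackgroundPropagators, (3.3) p.391] -/
theorem toL2_symm_DL2_toL2S_single_eq_zero (U₀ : GaugeField (F.P K) 0 (Matrix.specialUnitaryGroup (Fin 2) ℂ)) (x : Site (F.P K) 0) (A : Matrix (Fin 2) (Fin 2) ℂ)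
    {b : PBond (F.P K) 0} (hs : b.src ≠ x) (ht : b.tgt ≠ x) :
    (toL2 F K c₀).symm (DL2 F n K c₀ U₀ (toL2S F K c₀ (Pi.single x A))) b = 0 := by
  rw [toL2_symm_DL2_toL2S_single, if_neg ht, if_neg hs, sub_zero, smul_zero]

omit [Fact (0 < c₀)] in
/-- **THE TRANSPORTS PRESERVE THE FROBENIUS NORM**: `Σ_{jk}|(UAU⋆)_{jk}|² = Σ_{jk}|A_{jk}|²` for `U ∈ SU(2)`. [cite: Balaban1985Averaging, (18) p.21] -/
theorem sum_normSq_conj_specialUnitary (U : Matrix.specialUnitaryGroup (Fin 2) ℂ) (A : Matrix (Fin 2) (Fin 2) ℂ) :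
    ∑ j, ∑ k, ‖((U : Matrix (Fin 2) (Fin 2) ℂ) * A * star (U : Matrix (Fin 2) (Fin 2) ℂ)) j k‖ ^ 2 = ∑ j, ∑ k, ‖A j k‖ ^ 2 := by
  have hU : (U : Matrix (Fin 2) (Fin 2) ℂ)ᴴ * (U : Matrix (Fin 2) (Fin 2) ℂ) = 1 := by
    rw [← Matrix.star_eq_conjTranspose]; exact Matrix.mem_unitaryGroup_iff'.1 U.prop.1
  rw [MatrixNorms.sum_norm_sq_eq_re_trace, MatrixNorms.sum_norm_sq_eq_re_trace, Matrix.star_eq_conjTranspose]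
  congr 1
  rw [Matrix.conjTranspose_mul, Matrix.conjTranspose_mul, Matrix.conjTranspose_conjTranspose]
  have h1 : (U : Matrix (Fin 2) (Fin 2) ℂ) * (Aᴴ * (U : Matrix (Fin 2) (Fin 2) ℂ)ᴴ) * ((U : Matrix (Fin 2) (Fin 2) ℂ) * A * (U : Matrix (Fin 2) (Fin 2) ℂ)ᴴ)
      = (U : Matrix (Fin 2) (Fin 2) ℂ) * (Aᴴ * A * (U : Matrix (Fin 2) (Fin 2) ℂ)ᴴ) := by
    calc (U : Matrix (Fin 2) (Fin 2) ℂ) * (Aᴴ * (U : Matrix (Fin 2) (Fin 2) ℂ)ᴴ) * ((U : Matrix (Fin 2) (Fin 2) ℂ) * A * (U : Matrix (Fin 2) (Fin 2) ℂ)ᴴ)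
          = (U : Matrix (Fin 2) (Fin 2) ℂ) * (Aᴴ * (((U : Matrix (Fin 2) (Fin 2) ℂ)ᴴ * (U : Matrix (Fin 2) (Fin 2) ℂ)) * (A * (U : Matrix (Fin 2) (Fin 2) ℂ)ᴴ))) := by
            simp only [Matrix.mul_assoc]
      _ = (U : Matrix (Fin 2) (Fin 2) ℂ) * (Aᴴ * A * (U : Matrix (Fin 2) (Fin 2) ℂ)ᴴ) := by rw [hU, Matrix.one_mul, Matrix.mul_assoc]
  rw [h1, Matrix.trace_mul_comm, Matrix.mul_assoc, hU, Matrix.mul_one]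

omit [Fact (0 < c₀)] in
/-- Frobenius coordinates of a scalar multiple: `Σ|(r·M)_{jk}|² = |r|²·Σ|M_{jk}|²`. [folklore] -/
theorem sum_normSq_smul (r : ℂ) (M : Matrix (Fin 2) (Fin 2) ℂ) : ∑ j, ∑ k, ‖(r • M) j k‖ ^ 2 = ‖r‖ ^ 2 * ∑ j, ∑ k, ‖M j k‖ ^ 2 := by
  rw [Finset.mul_sum]
  refine Finset.sum_congr rfl fun j _ => ?_
  rw [Finset.mul_sum]
  refine Finset.sum_congr rfl fun k _ => ?_
  rw [Matrix.smul_apply, smul_eq_mul, norm_mul, mul_pow]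

omit [Fact (0 < c₀)] in
/-- **THREE BONDS LEAVE A SITE**: `Σ_b [b₋ = x]·c = 3c` (`d = 3`). [cite: Balaban1985Averaging, (5) p.18] -/
theorem sum_ite_src_eq (x : Site (F.P K) 0) (c : ℝ) : ∑ b : PBond (F.P K) 0, (if b.src = x then c else 0) = 3 * c := by
  let e : Site (F.P K) 0 × Fin (F.P K).d ≃ PBond (F.P K) 0 := ⟨fun p => ⟨p.1, p.2⟩, fun b => (b.src, b.dir), fun _ => rfl, fun _ => rfl⟩
  have hd : ((F.P K).d : ℝ) = 3 := by exact_mod_cast T3Family.P_d F K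
  rw [← Fintype.sum_equiv e (fun p => if p.1 = x then c else 0) _ (fun _ => rfl), Fintype.sum_prod_type, Finset.sum_comm]
  simp only [Finset.sum_ite_eq', Finset.mem_univ, if_true, Finset.sum_const, Finset.card_univ, Fintype.card_fin, nsmul_eq_mul, hd]

omit [Fact (0 < c₀)] in
/-- **THREE BONDS ENTER A SITE**: `Σ_b [b₊ = x]·c = 3c` (`b₊ = x ⟺ b₋ = x − e_{μ(b)}`). [cite: Balaban1985Averaging, (5) p.18] -/
theorem sum_ite_tgt_eq (x : Site (F.P K) 0) (c : ℝ) : ∑ b : PBond (F.P K) 0, (if b.tgt = x then c else 0) = 3 * c := by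
  let e : Site (F.P K) 0 × Fin (F.P K).d ≃ PBond (F.P K) 0 := ⟨fun p => ⟨p.1, p.2⟩, fun b => (b.src, b.dir), fun _ => rfl, fun _ => rfl⟩
  have hd : ((F.P K).d : ℝ) = 3 := by exact_mod_cast T3Family.P_d F K
  rw [← Fintype.sum_equiv e (fun p => if p.1.shift p.2 = x then c else 0) _ (fun _ => rfl), Fintype.sum_prod_type, Finset.sum_comm]
  have hμ : ∀ μ : Fin (F.P K).d, ∑ s : Site (F.P K) 0, (if s.shift μ = x then c else 0) = c := by
    intro μ
    have hiff : ∀ s : Site (F.P K) 0, s.shift μ = x ↔ s = x.unshift μ := fun s =>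
      ⟨fun h => by rw [← h, unshift_shift], fun h => by rw [h, shift_unshift]⟩
    simp_rw [hiff]
    simp only [Finset.sum_ite_eq', Finset.mem_univ, if_true]
  simp only [hμ, Finset.sum_const, Finset.card_univ, Fintype.card_fin, nsmul_eq_mul, hd, mul_comm]

/-- ★ **THE ENERGY OF A SPIKE**: `‖D_{U₀}(toL2S(δ_x⊗A))‖² = 6·c₀·η⁻²·Σ_{jk}|A_{jk}|²` — three outgoing bonds carry `−η⁻¹A`, three incoming bonds carry `η⁻¹U₀AU₀⋆` (same Frobenius norm), and
`b₊ ≠ b₋`. [cite: Balaban1985BackgroundPropagators, (3.3) p.391, (3.11) p.392] -/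
theorem normSq_DL2_toL2S_single_eq (U₀ : GaugeField (F.P K) 0 (Matrix.specialUnitaryGroup (Fin 2) ℂ)) (x : Site (F.P K) 0) (A : Matrix (Fin 2) (Fin 2) ℂ) :
    ‖DL2 F n K c₀ U₀ (toL2S F K c₀ (Pi.single x A))‖ ^ 2 = 6 * c₀ * (eta F n K)⁻¹ ^ 2 * ∑ j, ∑ k, ‖A j k‖ ^ 2 := by
  have hη : 0 < eta F n K := eta_pos F n K
  have hr : ‖(((eta F n K : ℝ) : ℂ)⁻¹)‖ ^ 2 = (eta F n K)⁻¹ ^ 2 := by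
    rw [norm_inv, Complex.norm_real, Real.norm_of_nonneg hη.le]
  obtain ⟨G, hG, hback⟩ : ∃ G : PBond (F.P K) 0 → Matrix (Fin 2) (Fin 2) ℂ, G = (toL2 F K c₀).symm (DL2 F n K c₀ U₀ (toL2S F K c₀ (Pi.single x A))) ∧
      DL2 F n K c₀ U₀ (toL2S F K c₀ (Pi.single x A)) = toL2 F K c₀ G := ⟨_, rfl, ((toL2 F K c₀).apply_symm_apply _).symm⟩
  -- bondwise Frobenius energy
  have hbond : ∀ b : PBond (F.P K) 0, ∑ j, ∑ k, ‖G b j k‖ ^ 2 =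
      (if b.tgt = x then (eta F n K)⁻¹ ^ 2 * ∑ j, ∑ k, ‖A j k‖ ^ 2 else 0) + (if b.src = x then (eta F n K)⁻¹ ^ 2 * ∑ j, ∑ k, ‖A j k‖ ^ 2 else 0) := by
    intro b
    rw [hG, toL2_symm_DL2_toL2S_single]
    by_cases ht : b.tgt = x
    · have hs : b.src ≠ x := fun hs => shift_ne_self' F b.src b.dir (by
        have h := ht
        change b.src.shift b.dir = x at h
        rw [h, hs])
      rw [if_pos ht, if_neg hs, if_pos ht, if_neg hs, sub_zero, add_zero, sum_normSq_smul, hr, sum_normSq_conj_specialUnitary]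
    · rw [if_neg ht, if_neg ht, zero_sub, zero_add, smul_neg]
      by_cases hs : b.src = x
      · rw [if_pos hs, if_pos hs]
        simp only [Matrix.neg_apply, norm_neg]
        rw [sum_normSq_smul, hr]
      · rw [if_neg hs, if_neg hs]; simp
  rw [hback, normSq_toL2_eq]
  simp_rw [hbond]
  rw [Finset.sum_add_distrib, sum_ite_tgt_eq, sum_ite_src_eq]
  ring

/-- **THE ENERGY OF A NORMALISED SPIKE**: `‖D_{U₀}((√c₀)⁻¹·toL2S(δ_x⊗E_{jk}))‖² = 6η⁻²`. [cite: Balaban1985BackgroundPropagators, (3.3) p.391, (3.11) p.392] -/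
theorem normSq_DL2_spike_eq (U₀ : GaugeField (F.P K) 0 (Matrix.specialUnitaryGroup (Fin 2) ℂ)) (x : Site (F.P K) 0) (j k : Fin 2) :
    ‖DL2 F n K c₀ U₀ ((((Real.sqrt c₀ : ℝ) : ℂ))⁻¹ • toL2S F K c₀ (Pi.single x (Matrix.single j k (1 : ℂ))))‖ ^ 2 = 6 * (eta F n K)⁻¹ ^ 2 := by
  have hc : 0 < c₀ := Fact.out
  have hone : ∑ j', ∑ k', ‖Matrix.single j k (1 : ℂ) j' k'‖ ^ 2 = 1 := by
    rw [Finset.sum_eq_single j, Finset.sum_eq_single k]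
    · rw [Matrix.single_apply_same, norm_one, one_pow]
    · intro k' _ hk'; rw [Matrix.single_apply_of_col_ne j j (Ne.symm hk'), norm_zero, zero_pow two_ne_zero]
    · intro h; exact absurd (Finset.mem_univ k) h
    · intro j' _ hj'; rw [Finset.sum_eq_zero]; intro k' _; rw [Matrix.single_apply_of_row_ne (Ne.symm hj'), norm_zero, zero_pow two_ne_zero]
    · intro h; exact absurd (Finset.mem_univ j) h
  rw [map_smul, norm_smul, mul_pow, normSq_DL2_toL2S_single_eq, hone, norm_inv, Complex.norm_real, Real.norm_of_nonneg (Real.sqrt_nonneg _), inv_pow,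
    Real.sq_sqrt hc.le]
  field_simp

/-! ## §3 Entries of `Δ_U` between spikes: range one, modulus `≤ 6η⁻²` -/

/-- ★★ **RANGE ONE**: if `x′` is neither `x` nor a lattice neighbour of `x` (`x′ ≠ x ± e_μ`), then `⟪toL2S(δ_{x′}⊗B), Δ^η_{U₀} toL2S(δ_x⊗A)⟫ = 0` — the two spike gradients live on
disjoint bond sets. [cite: Balaban1985BackgroundPropagators, (3.3) p.391, (3.23) p.394] -/
theorem inner_toL2S_single_covLapSite_eq_zero_of_far (U₀ : GaugeField (F.P K) 0 (Matrix.specialUnitaryGroup (Fin 2) ℂ)) {x x' : Site (F.P K) 0}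
    (hne : x' ≠ x) (hfwd : ∀ μ : Fin (F.P K).d, x' ≠ x.shift μ) (hbwd : ∀ μ : Fin (F.P K).d, x ≠ x'.shift μ) (A B : Matrix (Fin 2) (Fin 2) ℂ) :
    ⟪toL2S F K c₀ (Pi.single x' B), covLapSite F n K c₀ U₀ (toL2S F K c₀ (Pi.single x A))⟫_ℂ = 0 := by
  rw [inner_covLapSite_eq_inner_DL2]
  rw [← (toL2 F K c₀).apply_symm_apply (DL2 F n K c₀ U₀ (toL2S F K c₀ (Pi.single x' B))),
    ← (toL2 F K c₀).apply_symm_apply (DL2 F n K c₀ U₀ (toL2S F K c₀ (Pi.single x A))), inner_toL2, Finset.sum_eq_zero, mul_zero]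
  intro b _
  by_cases hs : b.src = x
  · have h1 : b.src ≠ x' := fun h => hne (h.symm.trans hs)
    have h2 : b.tgt ≠ x' := fun h => hfwd b.dir (by rw [← h, ← hs]; rfl)
    rw [toL2_symm_DL2_toL2S_single_eq_zero F U₀ x' B h1 h2, Matrix.conjTranspose_zero, Matrix.zero_mul, Matrix.trace_zero]
  · by_cases ht : b.tgt = x
    · have h1 : b.src ≠ x' := fun h => hbwd b.dir (by rw [← ht, ← h]; rfl)
      have h2 : b.tgt ≠ x' := fun h => hne (h.symm.trans ht)
      rw [toL2_symm_DL2_toL2S_single_eq_zero F U₀ x' B h1 h2, Matrix.conjTranspose_zero, Matrix.zero_mul, Matrix.trace_zero]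
    · rw [toL2_symm_DL2_toL2S_single_eq_zero F U₀ x A hs ht, Matrix.mul_zero, Matrix.trace_zero]

/-- ★ **ENTRY BOUND**: `|⟪toL2S(δ_{x′}⊗B), Δ^η_{U₀} toL2S(δ_x⊗A)⟫| ≤ ‖D(δ_{x′}⊗B)‖·‖D(δ_x⊗A)‖` (`= 6c₀η⁻²‖A‖_F‖B‖_F` by `normSq_DL2_toL2S_single_eq`). [cite: Balaban1985BackgroundPropagators, (3.23) p.394] -/
theorem norm_inner_toL2S_single_covLapSite_le (U₀ : GaugeField (F.P K) 0 (Matrix.specialUnitaryGroup (Fin 2) ℂ)) (x x' : Site (F.P K) 0) (A B : Matrix (Fin 2) (Fin 2) ℂ) :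
    ‖⟪toL2S F K c₀ (Pi.single x' B), covLapSite F n K c₀ U₀ (toL2S F K c₀ (Pi.single x A))⟫_ℂ‖
      ≤ ‖DL2 F n K c₀ U₀ (toL2S F K c₀ (Pi.single x' B))‖ * ‖DL2 F n K c₀ U₀ (toL2S F K c₀ (Pi.single x A))‖ := by
  rw [inner_covLapSite_eq_inner_DL2]
  exact norm_inner_le_norm _ _

/-- ★ **MATRIX ENTRIES OF `Δ_U` IN THE NORMALISED SPIKES ARE `≤ 6η⁻²` IN MODULUS** (the entry-size letter of (L3′a)'s budget). [cite: Balaban1985BackgroundPropagators, (3.23) p.394, (3.49) p.399] -/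
theorem norm_inner_spike_covLapSite_spike_le (U₀ : GaugeField (F.P K) 0 (Matrix.specialUnitaryGroup (Fin 2) ℂ)) (i l : Site (F.P K) 0 × (Fin 2 × Fin 2)) :
    ‖⟪(((Real.sqrt c₀ : ℝ) : ℂ))⁻¹ • toL2S F K c₀ (Pi.single i.1 (Matrix.single i.2.1 i.2.2 (1 : ℂ))),
        covLapSite F n K c₀ U₀ ((((Real.sqrt c₀ : ℝ) : ℂ))⁻¹ • toL2S F K c₀ (Pi.single l.1 (Matrix.single l.2.1 l.2.2 (1 : ℂ))))⟫_ℂ‖ ≤ 6 * (eta F n K)⁻¹ ^ 2 := by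
  rw [inner_covLapSite_eq_inner_DL2]
  refine (norm_inner_le_norm _ _).trans ?_
  have h1 := normSq_DL2_spike_eq F (n := n) (c₀ := c₀) U₀ i.1 i.2.1 i.2.2
  have h2 := normSq_DL2_spike_eq F (n := n) (c₀ := c₀) U₀ l.1 l.2.1 l.2.2
  have hpos : 0 ≤ 6 * (eta F n K)⁻¹ ^ 2 := by positivity
  nlinarith [norm_nonneg (DL2 F n K c₀ U₀ ((((Real.sqrt c₀ : ℝ) : ℂ))⁻¹ • toL2S F K c₀ (Pi.single i.1 (Matrix.single i.2.1 i.2.2 (1 : ℂ))))),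
    norm_nonneg (DL2 F n K c₀ U₀ ((((Real.sqrt c₀ : ℝ) : ℂ))⁻¹ • toL2S F K c₀ (Pi.single l.1 (Matrix.single l.2.1 l.2.2 (1 : ℂ)))))]

/-- **RANGE ONE IN THE NORMALISED SPIKES**. [cite: Balaban1985BackgroundPropagators, (3.23) p.394] -/
theorem inner_spike_covLapSite_spike_eq_zero_of_far (U₀ : GaugeField (F.P K) 0 (Matrix.specialUnitaryGroup (Fin 2) ℂ)) {i l : Site (F.P K) 0 × (Fin 2 × Fin 2)}
    (hne : i.1 ≠ l.1) (hfwd : ∀ μ : Fin (F.P K).d, i.1 ≠ l.1.shift μ) (hbwd : ∀ μ : Fin (F.P K).d, l.1 ≠ i.1.shift μ) :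
    ⟪(((Real.sqrt c₀ : ℝ) : ℂ))⁻¹ • toL2S F K c₀ (Pi.single i.1 (Matrix.single i.2.1 i.2.2 (1 : ℂ))),
        covLapSite F n K c₀ U₀ ((((Real.sqrt c₀ : ℝ) : ℂ))⁻¹ • toL2S F K c₀ (Pi.single l.1 (Matrix.single l.2.1 l.2.2 (1 : ℂ))))⟫_ℂ = 0 := by
  rw [map_smul, inner_smul_left, inner_smul_right, inner_toL2S_single_covLapSite_eq_zero_of_far F U₀ hne hfwd hbwd, mul_zero, mul_zero]

/-! ## §4 The cosh-budget row of `Δ_U` for site weights of neighbour-slope `s` -/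

/-- ★★ **THE COSH-BUDGET ROW OF `Δ_U`** (the `hrow` letter of ✓`Prop7HermitianCoshBudgetCT.inv_decay_of_hermitian_coshBudget`, `Δ_U` part): for site weights `ρ : T×T → ℝ` with
`ρ x x = 0` and `|ρ x x′| ≤ s` whenever `x′ = x ± e_μ`, every row of the spike matrix of `Δ^η_{U₀}` satisfies `Σ_l (cosh ρ(x_i,x_l) − 1)·|⟪e_i, Δ e_l⟫| ≤ 144·η⁻²·(cosh s − 1)`
(diagonal block free; at most `6 × 4` neighbour columns, each `≤ 6η⁻²`; all other entries vanish).  With the fine-Lipschitz Agmon weight (`s = μη`) the row is `≤ 144μ²·(cosh 1 − 1) ≤ 80μ²` for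
`μη ≤ 1` — free of `η`, `K` and the volume. [cite: Balaban1985BackgroundPropagators, (3.49) p.399, (3.23) p.394] -/
theorem coshBudget_row_covLapSite_le (U₀ : GaugeField (F.P K) 0 (Matrix.specialUnitaryGroup (Fin 2) ℂ)) (ρ : Site (F.P K) 0 → Site (F.P K) 0 → ℝ) {s : ℝ}
    (hρ0 : ∀ x, ρ x x = 0) (hρ : ∀ (x : Site (F.P K) 0) (μ : Fin (F.P K).d), |ρ x (x.shift μ)| ≤ s ∧ |ρ x (x.unshift μ)| ≤ s)
    (i : Site (F.P K) 0 × (Fin 2 × Fin 2)) :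
    ∑ l : Site (F.P K) 0 × (Fin 2 × Fin 2), (Real.cosh (ρ i.1 l.1) - 1) *
        ‖⟪(((Real.sqrt c₀ : ℝ) : ℂ))⁻¹ • toL2S F K c₀ (Pi.single i.1 (Matrix.single i.2.1 i.2.2 (1 : ℂ))),
            covLapSite F n K c₀ U₀ ((((Real.sqrt c₀ : ℝ) : ℂ))⁻¹ • toL2S F K c₀ (Pi.single l.1 (Matrix.single l.2.1 l.2.2 (1 : ℂ))))⟫_ℂ‖
      ≤ 144 * (eta F n K)⁻¹ ^ 2 * (Real.cosh s - 1) := by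
  classical
  have hs0 : 0 ≤ s := le_trans (abs_nonneg _) (hρ i.1 ⟨0, by rw [T3Family.P_d]; omega⟩).1
  have hcs : 0 ≤ Real.cosh s - 1 := by linarith [Real.one_le_cosh s]
  have hη2 : 0 ≤ 6 * (eta F n K)⁻¹ ^ 2 := by positivity
  -- the neighbour indicator
  let N : Site (F.P K) 0 → ℝ := fun x' => ∑ μ : Fin (F.P K).d, ((if x' = i.1.shift μ then (1 : ℝ) else 0) + (if x' = i.1.unshift μ then (1 : ℝ) else 0))
  -- termwise bound
  have hterm : ∀ l : Site (F.P K) 0 × (Fin 2 × Fin 2), (Real.cosh (ρ i.1 l.1) - 1) *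
      ‖⟪(((Real.sqrt c₀ : ℝ) : ℂ))⁻¹ • toL2S F K c₀ (Pi.single i.1 (Matrix.single i.2.1 i.2.2 (1 : ℂ))),
          covLapSite F n K c₀ U₀ ((((Real.sqrt c₀ : ℝ) : ℂ))⁻¹ • toL2S F K c₀ (Pi.single l.1 (Matrix.single l.2.1 l.2.2 (1 : ℂ))))⟫_ℂ‖
        ≤ N l.1 * ((Real.cosh s - 1) * (6 * (eta F n K)⁻¹ ^ 2)) := by
    intro l
    have hN0 : 0 ≤ N l.1 := Finset.sum_nonneg fun μ _ => add_nonneg (by split_ifs <;> norm_num) (by split_ifs <;> norm_num)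
    by_cases hxx : l.1 = i.1
    · -- diagonal block: weight difference zero
      have h0 : Real.cosh (ρ i.1 l.1) - 1 = 0 := by rw [hxx, hρ0, Real.cosh_zero, sub_self]
      rw [h0, zero_mul]
      exact mul_nonneg hN0 (mul_nonneg hcs hη2)
    · by_cases hnb : ∃ μ : Fin (F.P K).d, l.1 = i.1.shift μ ∨ l.1 = i.1.unshift μ
      · -- neighbour column: `N ≥ 1`
        obtain ⟨μ, hμ⟩ := hnb
        have hN1 : 1 ≤ N l.1 := by
          have hle : ((if l.1 = i.1.shift μ then (1 : ℝ) else 0) + (if l.1 = i.1.unshift μ then (1 : ℝ) else 0)) ≤ N l.1 :=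
            Finset.single_le_sum (f := fun μ => (if l.1 = i.1.shift μ then (1 : ℝ) else 0) + (if l.1 = i.1.unshift μ then (1 : ℝ) else 0))
              (fun μ _ => add_nonneg (by split_ifs <;> norm_num) (by split_ifs <;> norm_num)) (Finset.mem_univ μ)
          refine le_trans ?_ hle
          rcases hμ with h | h
          · rw [if_pos h]; have : (0 : ℝ) ≤ if l.1 = i.1.unshift μ then 1 else 0 := by split_ifs <;> norm_num
            linarith
          · rw [if_pos h]; have : (0 : ℝ) ≤ if l.1 = i.1.shift μ then 1 else 0 := by split_ifs <;> norm_num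
            linarith
        have hw : Real.cosh (ρ i.1 l.1) - 1 ≤ Real.cosh s - 1 := by
          have hb : |ρ i.1 l.1| ≤ s := by
            rcases hμ with h | h
            · rw [h]; exact (hρ i.1 μ).1
            · rw [h]; exact (hρ i.1 μ).2
          have := Real.cosh_le_cosh.2 (show |ρ i.1 l.1| ≤ |s| by rwa [abs_of_nonneg hs0])
          linarith
        have hw0 : 0 ≤ Real.cosh (ρ i.1 l.1) - 1 := by linarith [Real.one_le_cosh (ρ i.1 l.1)]
        calc (Real.cosh (ρ i.1 l.1) - 1) * _ ≤ (Real.cosh s - 1) * (6 * (eta F n K)⁻¹ ^ 2) :=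
              mul_le_mul hw (norm_inner_spike_covLapSite_spike_le F U₀ i l) (norm_nonneg _) hcs
          _ = 1 * ((Real.cosh s - 1) * (6 * (eta F n K)⁻¹ ^ 2)) := (one_mul _).symm
          _ ≤ N l.1 * ((Real.cosh s - 1) * (6 * (eta F n K)⁻¹ ^ 2)) := mul_le_mul_of_nonneg_right hN1 (mul_nonneg hcs hη2)
      · -- far column: entry zero
        simp only [not_exists, not_or] at hnb
        have hz := inner_spike_covLapSite_spike_eq_zero_of_far F (n := n) (c₀ := c₀) U₀ (i := i) (l := l) (Ne.symm hxx)
          (fun μ h => (hnb μ).2 (by rw [h, unshift_shift])) (fun μ h => (hnb μ).1 h)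
        rw [hz, norm_zero, mul_zero]
        exact mul_nonneg hN0 (mul_nonneg hcs hη2)
  -- `Σ_{x'} N x' = 6`, `Σ_l N l.1 = 24`
  have hd : ((F.P K).d : ℝ) = 3 := by exact_mod_cast T3Family.P_d F K
  have hN6 : ∑ x' : Site (F.P K) 0, N x' = 6 := by
    show ∑ x' : Site (F.P K) 0, ∑ μ : Fin (F.P K).d, ((if x' = i.1.shift μ then (1 : ℝ) else 0) + (if x' = i.1.unshift μ then (1 : ℝ) else 0)) = 6
    rw [Finset.sum_comm]
    simp only [Finset.sum_add_distrib, Finset.sum_ite_eq', Finset.mem_univ, if_true, Finset.sum_const, Finset.card_univ, Fintype.card_fin, nsmul_eq_mul, hd]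
    norm_num
  have hN24 : ∑ l : Site (F.P K) 0 × (Fin 2 × Fin 2), N l.1 = 24 := by
    rw [Fintype.sum_prod_type]
    simp only [Finset.sum_const, Finset.card_univ, Fintype.card_prod, Fintype.card_fin, nsmul_eq_mul]
    rw [← Finset.mul_sum, hN6]
    norm_num
  refine (Finset.sum_le_sum fun l _ => hterm l).trans (le_of_eq ?_)
  rw [← Finset.sum_mul, hN24]
  ring

end Summit.QuantumFields.YangMills.Theorems.Prop7CovLapSiteEntryRows

end
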